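import Summits.Ventures.PercRepro.C025Profile

/-!
# PercRepro — C-032 PROFILE (Π): the single-coloop arithmetic step of `(Π_{1,u})` (night-3, gen 6)

On a simple matroid of rank `R` with `m` non-coloops and `c` coloops the right side of `(Π_{1,u})` is
`T1 m R c u = [u ≤ R]·(m·C(R+1,u)/(R+1) + c·[u+1 ≤ R]·C(R,u)/R)` (the points are the rank-`1` sets; a non-coloop `x`
has `ρ(E ∖ x) = R`, a coloop has `ρ(E ∖ x) = R − 1`; `C025ProfileOne.lean`, `sum_price_eq_T1`).  Adding one coloop
to a matroid `M'` of rank `R` gives a matroid of rank `R + 1` whose level `u` is `levelSet M' u ⊔ levelSet M' (u−1)`,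
so the induction on the coloops needs exactly

  `T1 m (R+1) (c+1) u ≤ T1 m R c u + T1 m R c (u−1)`        (`T1_step`, for `u ≥ 1`, `R ≥ 1`, `m ≥ 2`, `m + c ≥ R + 1`),

which is Pascal's rule `C(R+2,u) = C(R+1,u) + C(R+1,u−1)` plus the ratio `C(R+1,u−1)·(R+2−u) = C(R+1,u)·u`
(`Nat.choose_succ_right_eq`): the `m`-terms gain `m·C(R+2,u)/((R+1)(R+2))`, which pays the new coloop's price
`C(R+1,u)/(R+1)` because `m ≥ R − c + 1` (`T_step`, five cases in `u`).  No other binomial inequality is needed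
(NIGHT3-G6-PROFILE.md §8 used two; this route replaces them).

* `Profile.T`, `Profile.T1` — the closed forms; `Profile.two_mul_choose_add_two` — `2·C(n+2,n) = (n+1)(n+2)`;
* **`Profile.T_step`**, **`Profile.T1_step`** — the step.
-/

namespace PercRepro

open Finset

namespace Profile



/-- The closed form of the right side of `(Π_{1,u})` on a simple matroid of rank `R` with `m` non-coloops and
`c` coloops: `m·C(R+1,u)/(R+1) + c·[u ≤ R−1]·C(R,u)/R`. -/
noncomputable def T (m R c u : ℕ) : ℚ :=
  (m : ℚ) * (Nat.choose (R + 1) u : ℚ) / ((R : ℚ) + 1) +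
    (c : ℚ) * (if u + 1 ≤ R then (Nat.choose R u : ℚ) / (R : ℚ) else 0)

/-- `2·C(n+2, n) = (n+1)(n+2)`. -/
theorem two_mul_choose_add_two (n : ℕ) : 2 * Nat.choose (n + 2) n = (n + 1) * (n + 2) := by
  rw [Nat.choose_symm_add]
  have h := Nat.add_one_mul_choose_eq (n + 1) 1
  rw [Nat.choose_one_right] at h
  -- h : (n+2) * (n+1) = (n+2).choose 2 * 2
  have : Nat.choose (n + 2) 2 * 2 = (n + 1 + 1) * (n + 1) := h.symm
  linarith [this]

set_option maxHeartbeats 400000 in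
/-- **The single-coloop step**: with `m ≥ 2` non-coloops, `m ≥ R − c + 1` and rank `R ≥ 1`,
`T m (R+1) (c+1) u ≤ T m R c u + T m R c (u−1)` for every `u ≥ 1`. -/
theorem T_step (m R c u : ℕ) (hR : 1 ≤ R) (hm : R + 1 ≤ m + c) (hm2 : 2 ≤ m) :
    T m (R + 1) (c + 1) (u + 1) ≤ T m R c (u + 1) + T m R c u := by
  unfold T
  have hRq : (0 : ℚ) < R := by exact_mod_cast hR
  have hR1 : (0 : ℚ) < (R : ℚ) + 1 := by positivity
  have hR2 : (0 : ℚ) < (R : ℚ) + 1 + 1 := by positivity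
  have hmq : (2 : ℚ) ≤ m := by exact_mod_cast hm2
  have hmc : (R : ℚ) + 1 ≤ (m : ℚ) + c := by exact_mod_cast hm
  have hcq : (0 : ℚ) ≤ c := Nat.cast_nonneg _
  have hP1 : (Nat.choose (R + 1 + 1) (u + 1) : ℚ) = Nat.choose (R + 1) (u + 1) + Nat.choose (R + 1) u := by
    rw [Nat.choose_succ_succ' (R + 1) u]; push_cast; ring
  have hP2 : (Nat.choose (R + 1) (u + 1) : ℚ) = Nat.choose R (u + 1) + Nat.choose R u := by
    rw [Nat.choose_succ_succ' R u]; push_cast; ring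
  have hKnat : Nat.choose (R + 1) u * (R + 1 - u) = Nat.choose (R + 1) (u + 1) * (u + 1) :=
    (Nat.choose_succ_right_eq (R + 1) u).symm
  set a : ℚ := ((R + 1).choose (u + 1) : ℚ) with ha
  set b : ℚ := ((R + 1).choose u : ℚ) with hb
  have ha0 : (0 : ℚ) ≤ a := Nat.cast_nonneg _
  have hb0 : (0 : ℚ) ≤ b := Nat.cast_nonneg _
  have hab : (Nat.choose (R + 1 + 1) (u + 1) : ℚ) = a + b := hP1
  rw [hab]
  rcases (by omega : u + 2 ≤ R ∨ u + 1 = R ∨ u = R ∨ u = R + 1 ∨ R + 2 ≤ u) with h | h | h | h | h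
  · -- (A) u + 2 ≤ R: all three indicators hold
    rw [if_pos (by omega : u + 1 + 1 ≤ R + 1), if_pos h, if_pos (by omega : u + 1 ≤ R)]
    push_cast
    have hsum : (Nat.choose R (u + 1) : ℚ) + Nat.choose R u = a := hP2.symm
    have hKq : b * ((R : ℚ) + 1 - u) = a * ((u : ℚ) + 1) := by
      have hcast : ((R + 1 - u : ℕ) : ℚ) = (R : ℚ) + 1 - u := by
        rw [Nat.cast_sub (by omega)]; push_cast; ring
      have := congrArg (fun n : ℕ => (n : ℚ)) hKnat
      push_cast at this
      rw [hcast] at this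
      exact this
    have hc' : (c : ℚ) * ((Nat.choose R (u + 1) : ℚ) / R) + (c : ℚ) * ((Nat.choose R u : ℚ) / R) = (c : ℚ) * (a / R) := by
      rw [← mul_add, ← add_div, hsum]
    have hRu : (0 : ℚ) < (R : ℚ) + 1 - u := by
      have : (u : ℚ) + 2 ≤ R := by exact_mod_cast h
      linarith
    have hab2 : (a + b) * ((R : ℚ) + 1 - u) = a * ((R : ℚ) + 2) := by linarith [hKq]
    have key : a * ((R : ℚ) - c) * ((R : ℚ) + 2) ≤ (m : ℚ) * (a + b) * R := by
      have hu0 : (0 : ℚ) ≤ u := Nat.cast_nonneg u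
      have hRc : ((R : ℚ) - c) * ((R : ℚ) + 1 - u) ≤ (m : ℚ) * R := by
        rcases le_or_gt ((R : ℚ) - c) 0 with hneg | hpos
        · have : ((R : ℚ) - c) * ((R : ℚ) + 1 - u) ≤ 0 := mul_nonpos_of_nonpos_of_nonneg hneg hRu.le
          nlinarith [this, hmq, hRq]
        · have h1 : ((R : ℚ) - c) * ((R : ℚ) + 1 - u) ≤ ((R : ℚ) - c) * ((R : ℚ) + 1) :=
            mul_le_mul_of_nonneg_left (by linarith) hpos.le
          have h2 : ((R : ℚ) - c) * ((R : ℚ) + 1) ≤ (m : ℚ) * R := by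
            have h3 : ((R : ℚ) - c + 1) * R ≤ (m : ℚ) * R := mul_le_mul_of_nonneg_right (by linarith) hRq.le
            nlinarith [h3, hcq, hRq]
          linarith
      have e1 : (m : ℚ) * (a + b) * R * ((R : ℚ) + 1 - u) = (m : ℚ) * R * (a * ((R : ℚ) + 2)) := by
        rw [← hab2]; ring
      have : a * ((R : ℚ) - c) * ((R : ℚ) + 2) * ((R : ℚ) + 1 - u) ≤ (m : ℚ) * (a + b) * R * ((R : ℚ) + 1 - u) := by
        rw [e1]
        have := mul_le_mul_of_nonneg_left hRc ha0
        nlinarith [this, ha0, hR2, mul_nonneg ha0 hR2.le]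
      exact le_of_mul_le_mul_right this hRu
    have hL : ((c : ℚ) + 1) * (a / ((R : ℚ) + 1)) - (c : ℚ) * (a / R) = a * ((R : ℚ) - c) / (R * ((R : ℚ) + 1)) := by
      field_simp
      ring
    have hRt : (m : ℚ) * (a + b) / ((R : ℚ) + 1) - (m : ℚ) * (a + b) / ((R : ℚ) + 1 + 1) =
        (m : ℚ) * (a + b) / (((R : ℚ) + 1) * ((R : ℚ) + 1 + 1)) := by
      field_simp
      ring
    have hmain : a * ((R : ℚ) - c) / (R * ((R : ℚ) + 1)) ≤ (m : ℚ) * (a + b) / (((R : ℚ) + 1) * ((R : ℚ) + 1 + 1)) := by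
      rw [div_le_div_iff₀ (by positivity) (by positivity)]
      have h5 : a * ((R : ℚ) - c) * (((R : ℚ) + 1) * ((R : ℚ) + 1 + 1)) = a * ((R : ℚ) - c) * ((R : ℚ) + 2) * ((R : ℚ) + 1) := by ring
      have h6 : (m : ℚ) * (a + b) * (R * ((R : ℚ) + 1)) = (m : ℚ) * (a + b) * R * ((R : ℚ) + 1) := by ring
      rw [h5, h6]
      exact mul_le_mul_of_nonneg_right key hR1.le
    have hc'' : (c : ℚ) * ((Nat.choose R (u + 1) : ℚ) / R) + (c : ℚ) * ((Nat.choose R u : ℚ) / R) = (c : ℚ) * (a / R) := hc'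
    have hsplit : (m : ℚ) * a / ((R : ℚ) + 1) + (m : ℚ) * b / ((R : ℚ) + 1) = (m : ℚ) * (a + b) / ((R : ℚ) + 1) := by ring
    linarith [hL, hRt, hmain, hc'', hsplit]
  · -- (B) u + 1 = R: a = u + 2, a + b = C(u+3, u+1), 2(a+b) = (u+2)(u+3)
    subst h
    rw [if_pos (by omega : u + 1 + 1 ≤ u + 1 + 1), if_neg (by omega : ¬ (u + 1 + 1 ≤ u + 1)), if_pos (le_refl _)]
    have ha1 : a = (u : ℚ) + 2 := by
      rw [ha, show u + 1 + 1 = (u + 1) + 1 by rfl, Nat.choose_succ_self_right]; push_cast; ring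
    have hS : 2 * (a + b) = ((u : ℚ) + 2) * ((u : ℚ) + 3) := by
      rw [← hab]
      have := two_mul_choose_add_two (u + 1)
      have h' : ((2 * Nat.choose (u + 1 + 2) (u + 1) : ℕ) : ℚ) = (((u + 1 + 1) * (u + 1 + 2) : ℕ) : ℚ) := by
        exact_mod_cast this
      push_cast at h'
      rw [show u + 1 + 1 + 1 = u + 1 + 2 by rfl]
      linarith [h']
    have hC : (Nat.choose (u + 1) u : ℚ) = (u : ℚ) + 1 := by rw [Nat.choose_succ_self_right]; push_cast; rfl
    rw [hC]
    push_cast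
    have huq : (0 : ℚ) ≤ u := Nat.cast_nonneg u
    have hu1 : (0 : ℚ) < (u : ℚ) + 1 := by positivity
    have hu2 : (0 : ℚ) < (u : ℚ) + 1 + 1 := by positivity
    have hu3 : (0 : ℚ) < (u : ℚ) + 1 + 1 + 1 := by positivity
    have hcterm : (c : ℚ) * (((u : ℚ) + 1) / ((u : ℚ) + 1)) = c := by rw [div_self (ne_of_gt hu1), mul_one]
    have hsplit : (m : ℚ) * a / ((u : ℚ) + 1 + 1) + (m : ℚ) * b / ((u : ℚ) + 1 + 1) = (m : ℚ) * (a + b) / ((u : ℚ) + 1 + 1) := by ring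
    have hkey : (m : ℚ) * (a + b) / ((u : ℚ) + 1 + 1 + 1) + 1 ≤ (m : ℚ) * (a + b) / ((u : ℚ) + 1 + 1) := by
      have hd : (m : ℚ) * (a + b) / ((u : ℚ) + 1 + 1) - (m : ℚ) * (a + b) / ((u : ℚ) + 1 + 1 + 1) =
          (m : ℚ) * (a + b) / (((u : ℚ) + 1 + 1) * ((u : ℚ) + 1 + 1 + 1)) := by
        field_simp; ring
      have h1 : (1 : ℚ) ≤ (m : ℚ) * (a + b) / (((u : ℚ) + 1 + 1) * ((u : ℚ) + 1 + 1 + 1)) := by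
        rw [le_div_iff₀ (by positivity)]
        have h2 : 2 * (a + b) ≤ (m : ℚ) * (a + b) := by
          have := mul_le_mul_of_nonneg_right hmq (add_nonneg ha0 hb0)
          linarith
        have h3 : ((u : ℚ) + 2) * ((u : ℚ) + 3) = 1 * (((u : ℚ) + 1 + 1) * ((u : ℚ) + 1 + 1 + 1)) := by ring
        linarith [h2, hS, h3]
      linarith [hd, h1]
    have hca : ((c : ℚ) + 1) * (a / ((u : ℚ) + 1 + 1)) = c + 1 := by
      rw [ha1, show ((u : ℚ) + 2) / ((u : ℚ) + 1 + 1) = 1 by rw [div_eq_one_iff_eq (ne_of_gt hu2)]; ring, mul_one]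
    show (m : ℚ) * (a + b) / ((u : ℚ) + 1 + 1 + 1) + ((c : ℚ) + 1) * (a / ((u : ℚ) + 1 + 1)) ≤
      (m : ℚ) * a / ((u : ℚ) + 1 + 1) + (c : ℚ) * 0 + ((m : ℚ) * b / ((u : ℚ) + 1 + 1) + (c : ℚ) * (((u : ℚ) + 1) / ((u : ℚ) + 1)))
    linarith [hkey, hca, hcterm, hsplit]
  · -- (C) u = R: a = 1, b = u + 1, every indicator false
    subst h
    rw [if_neg (by omega : ¬ (u + 1 + 1 ≤ u + 1)), if_neg (by omega : ¬ (u + 1 + 1 ≤ u)), if_neg (by omega : ¬ (u + 1 ≤ u))]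
    have hab0 : (0 : ℚ) ≤ a + b := add_nonneg ha0 hb0
    have hm0 : (0 : ℚ) ≤ (m : ℚ) * (a + b) := mul_nonneg (Nat.cast_nonneg m) hab0
    push_cast
    have hsplit : (m : ℚ) * a / ((u : ℚ) + 1) + (m : ℚ) * b / ((u : ℚ) + 1) = (m : ℚ) * (a + b) / ((u : ℚ) + 1) := by ring
    have hmono : (m : ℚ) * (a + b) / ((u : ℚ) + 1 + 1) ≤ (m : ℚ) * (a + b) / ((u : ℚ) + 1) :=
      div_le_div_of_nonneg_left hm0 (by positivity) (by linarith)
    simp only [mul_zero, add_zero]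
    linarith [hsplit, hmono]
  · -- (D) u = R + 1: a = 0, b = 1
    subst h
    rw [if_neg (by omega : ¬ (R + 1 + 1 + 1 ≤ R + 1)), if_neg (by omega : ¬ (R + 1 + 1 + 1 ≤ R)),
      if_neg (by omega : ¬ (R + 1 + 1 ≤ R))]
    have ha1 : a = 0 := by rw [ha, Nat.choose_eq_zero_of_lt (by omega)]; rfl
    have hb1 : b = 1 := by rw [hb, Nat.choose_self]; rfl
    rw [ha1, hb1]
    simp only [mul_zero, add_zero, zero_add, mul_one, zero_div]
    push_cast
    exact div_le_div_of_nonneg_left (Nat.cast_nonneg m) (by positivity) (by linarith)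
  · -- (E) u ≥ R + 2: a = b = 0
    rw [if_neg (by omega : ¬ (u + 1 + 1 ≤ R + 1)), if_neg (by omega : ¬ (u + 1 + 1 ≤ R)),
      if_neg (by omega : ¬ (u + 1 ≤ R))]
    have ha1 : a = 0 := by rw [ha, Nat.choose_eq_zero_of_lt (by omega)]; rfl
    have hb1 : b = 0 := by rw [hb, Nat.choose_eq_zero_of_lt (by omega)]; rfl
    rw [ha1, hb1]
    simp


/-- The right side of `(Π_{1,u})` on a simple matroid: `T` below the rank, `0` above it. -/
noncomputable def T1 (m R c u : ℕ) : ℚ := if u ≤ R then T m R c u else 0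

/-- `T1_step`: the single-coloop step for `T1`. -/
theorem T1_step (m R c u : ℕ) (hR : 1 ≤ R) (hm : R + 1 ≤ m + c) (hm2 : 2 ≤ m) :
    T1 m (R + 1) (c + 1) (u + 1) ≤ T1 m R c (u + 1) + T1 m R c u := by
  unfold T1
  rcases (by omega : u + 1 ≤ R ∨ u + 1 = R + 1 ∨ R + 2 ≤ u + 1) with h | h | h
  · rw [if_pos (by omega), if_pos h, if_pos (by omega)]
    exact T_step m R c u hR hm hm2
  · rw [if_pos (by omega), if_neg (by omega), if_pos (by omega)]
    have hu : u = R := by omega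
    subst hu
    unfold T
    rw [if_neg (by omega), if_neg (by omega)]
    have h1 : (Nat.choose (u + 1 + 1) (u + 1) : ℚ) = (u : ℚ) + 2 := by
      rw [Nat.choose_succ_self_right]; push_cast; ring
    have h2 : (Nat.choose (u + 1) u : ℚ) = (u : ℚ) + 1 := by
      rw [Nat.choose_succ_self_right]; push_cast; rfl
    rw [h1, h2]
    push_cast
    have hu2 : (0 : ℚ) < (u : ℚ) + 1 + 1 := by positivity
    have hu1 : (0 : ℚ) < (u : ℚ) + 1 := by positivity
    rw [mul_zero, add_zero, mul_zero, add_zero, zero_add]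
    rw [show (m : ℚ) * ((u : ℚ) + 2) / ((u : ℚ) + 1 + 1) = m by field_simp; ring,
      show (m : ℚ) * ((u : ℚ) + 1) / ((u : ℚ) + 1) = m by field_simp]
  · rw [if_neg (by omega)]
    have h1 : (0 : ℚ) ≤ (if u + 1 ≤ R then T m R c (u + 1) else 0) := by
      split_ifs
      · unfold T; positivity
      · exact le_rfl
    have h2 : (0 : ℚ) ≤ (if u ≤ R then T m R c u else 0) := by
      split_ifs
      · unfold T; positivity
      · exact le_rfl
    linarith

end Profile

end PercRepro
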